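import Literature.NumberTheory.Automorphic.RankinSelbergLocalUniqueness
import Literature.NumberTheory.Automorphic.IrreducibleClasses
import HarnessLib

/-!
# Named fact: a generic representation of `GL_n(F)` all of whose Rankin–Selberg `L`-factors against
supercuspidal representations of smaller rank are trivial is supercuspidal (Henniart 2002,
Thm. 1.6 (b); Jacquet–Piatetski-Shapiro–Shalika 1983)

Companion of `GL2LocalLFactorNonSupercuspidal` (`Bump1997_gl2_exists_twist_rsLFactor_ne_one`, the
rank-2 case in contrapositive form: a generic non-supercuspidal `π` of `GL₂(F)` has a quasi-character
twist with non-trivial `L`-factor) for every rank `n ≥ 2`.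

Printed statement (G. Henniart, *Une caractérisation de la correspondance de Langlands locale pour
`GL(n)`*, Bull. SMF 130 (2002), Thm. 1.6 (b), p. 590–591): *let `n ≥ 2` and `π ∈ A(n)` (an
irreducible smooth representation of `GL_n(F)`); the following are equivalent: (i) `π ∈ A⁰(n)`
(supercuspidal); (ii) for `r = 1, …, n - 1` and `ρ ∈ A⁰(r)`, `L(s, π × ρ) = 1`; (iii) for such
`r, ρ`, `γ(s, π × ρ, ψ)` is a monomial in `q^{-s}`* — with `L(s, π × ρ)` the factor of
Jacquet–Piatetski-Shapiro–Shalika 1983 ((i) ⇒ (ii): [JPSS 1983, (8.1)], quoted in the Remarque of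
§1.4; (ii) ⇒ (i): §3.3–3.4, via the supercuspidal support and the poles of `L(s, π × ρ^∨)`).

Tree form: `Henniart2002_isSupercuspidal_of_forall_hasRSLFactor_eq_one`, the implication
(ii) ⇒ (i) for GENERIC `π` (the range in which the tree's `HasRSLFactor` — JPSS's `L`-polynomial
through the zeta integrals of Whittaker functions of `π` w.r.t. `ψ` and of `ρ` w.r.t. `ψ⁻¹`,
Thm. 2.7 (i)–(ii) — IS the printed `L(s, π × ρ)`).  Hypothesis (ii) is transcribed as: for every
continuous non-trivial `ψ` for which `π` is generic, every `1 ≤ r < n`, every supercuspidal `ρ` of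
`GL_r(F)` generic for `ψ⁻¹` (all of them are: Gelfand–Kazhdan 1975, the tree's named fact
`isGeneric_of_isSupercuspidal`; keeping the genericity of `ρ` explicit makes the hypothesis the
literal precondition of `HasRSLFactor`), every `GL_r(F)`-invariant Radon measure `ν` positive on
opens on `GL_r(F) ⧸ U_r` (the `dh` of the zeta integrals) and every polynomial `P` with
`HasRSLFactor … π ρ ψ ν P`, one has `P = 1`.  "Supercuspidal" is Harish-Chandra's notion
`Representation.IsSupercuspidal` (compactly supported matrix coefficients modulo the centre; =
vanishing of the Jacquet modules for `GL_n`, the tree's `isSupercuspidal_iff_jacquetGL`), the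
`A⁰(n)` of the source.

## Deliberately NOT here

* (i) ⇒ (ii) ([JPSS 1983, (8.1)]) and the `γ`-monomial clause (iii);
* Thm. 1.6 (a) (Galois side; elementary, proved `Summits`-side where needed) and the Corollaire;
* the discharge `…_holds` (Bernstein–Zelevinsky derivatives / JPSS §8–9).
-/

noncomputable section

open scoped MatrixGroups Polynomial
open MeasureTheory

namespace Literature.NumberTheory.Automorphic

/-- **Henniart 2002, Thm. 1.6 (b), (ii) ⇒ (i), for generic `π`** (named fact, D-0014).  Let
`n ≥ 2` and let `π` be an irreducible smooth representation of `GL_n(F)`, generic for some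
continuous non-trivial additive character.  Suppose that for every continuous non-trivial `ψ` for
which `π` is `ψ`-generic, every `r` with `1 ≤ r ≤ n - 1`, every supercuspidal irreducible smooth
`ρ` of `GL_r(F)` that is `ψ⁻¹`-generic, every `GL_r(F)`-invariant Borel measure `ν` on
`GL_r(F) ⧸ U_r` finite on compact sets and positive on non-empty open sets, and every polynomial
`P`, `HasRSLFactor … π ρ ψ ν P → P = 1` — i.e. the Jacquet–Piatetski-Shapiro–Shalika `L`-factor
`L(s, π × ρ) = P(q^{-s})⁻¹` is `1` for all supercuspidal `ρ` of smaller rank.  Then `π` is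
supercuspidal (`Representation.IsSupercuspidal`, Harish-Chandra).  Print: Henniart 2002 Thm. 1.6
(b) ((i) ⇔ (ii) for all `π ∈ A(n)`; proof of (ii) ⇒ (i) in §3.3–3.4: a non-supercuspidal `π` has
supercuspidal support `{ν^{α}ρ_i}` with some `r_i < n`, and `L(s, π × ρ_i^∨)` has a pole);
the `L`-factors are those of Jacquet–Piatetski-Shapiro–Shalika 1983, Thm. 2.7, which for generic
pairs are the tree's `HasRSLFactor`.  The rank-2 case in contrapositive form is
`Bump1997_gl2_exists_twist_rsLFactor_ne_one`.
[cite: HenniartBSMF2002, Thm. 1.6 (b)] [cite: JacquetPiatetskiShapiroShalika1983, Thm. 2.7 and (8.1)] -/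
def Henniart2002_isSupercuspidal_of_forall_hasRSLFactor_eq_one (F : Type) [Field F]
    [ValuativeRel F] [TopologicalSpace F] [IsNonarchimedeanLocalField F] : Prop :=
  ∀ (n : ℕ), 2 ≤ n → ∀ (π : SmoothIrrep (GL (Fin n) F)),
    (∃ ψ : AddChar F Circle, ψ.IsContinuousNontrivial ∧ IsGeneric π.ρ ψ) →
    (∀ (ψ : AddChar F Circle), ψ.IsContinuousNontrivial → IsGeneric π.ρ ψ →
      ∀ (r : ℕ), 0 < r → ∀ (hrn : r < n) (ρ : SmoothIrrep (GL (Fin r) F)),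
        ρ.ρ.IsSupercuspidal → IsGeneric ρ.ρ ψ⁻¹ →
        ∀ [MeasurableSpace (GL (Fin r) F ⧸ upperUnitriangular (Fin r) F)]
          [BorelSpace (GL (Fin r) F ⧸ upperUnitriangular (Fin r) F)]
          (ν : Measure (GL (Fin r) F ⧸ upperUnitriangular (Fin r) F))
          [SMulInvariantMeasure (GL (Fin r) F) (GL (Fin r) F ⧸ upperUnitriangular (Fin r) F) ν]
          [IsFiniteMeasureOnCompacts ν] [ν.IsOpenPosMeasure] (P : ℂ[X]),
          HasRSLFactor hrn π.ρ ρ.ρ ψ ν P → P = 1) →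
    π.ρ.IsSupercuspidal

/-- **Henniart 2002, Thm. 1.6 (b), (ii) ⇒ (i), for generic `π` — existence-included form** (named
fact, D-0014).  The same printed implication with hypothesis (ii) transcribed as "`L(s, π × ρ)`
EXISTS AND EQUALS `1`": for every continuous non-trivial `ψ` for which `π` is `ψ`-generic, every
`1 ≤ r ≤ n - 1`, every supercuspidal `ψ⁻¹`-generic irreducible smooth `ρ` of `GL_r(F)` and every
`GL_r(F)`-invariant Borel measure `ν` on `GL_r(F) ⧸ U_r` finite on compacts and positive on non-empty
opens, `HasRSLFactor … π ρ ψ ν 1` (the constant polynomial `1` IS a Jacquet–Piatetski-Shapiro–Shalika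
`L`-polynomial of the pair); conclusion: `π` is supercuspidal.  This form is WEAKER than
`Henniart2002_isSupercuspidal_of_forall_hasRSLFactor_eq_one` (its hypothesis also asserts the
existence of the `L`-polynomial, so it cannot hold vacuously where the predicate `HasRSLFactor` is
unsatisfied; the implication from the `… → P = 1` form is
`Henniart2002_isSupercuspidal_of_forall_hasRSLFactor_one_of_eq_one`, by the proved uniqueness
`HasRSLFactor.unique`), and it is the form a local Langlands correspondence preserving `L`-factors
of pairs delivers (clause (iii-L) of `IsLocalLanglandsGL` read at the Galois-side value `1`).
Print: Henniart 2002 Thm. 1.6 (b); JPSS 1983 Thm. 2.7.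
[cite: HenniartBSMF2002, Thm. 1.6 (b)] [cite: JacquetPiatetskiShapiroShalika1983, Thm. 2.7 and (8.1)] -/
def Henniart2002_isSupercuspidal_of_forall_hasRSLFactor_one (F : Type) [Field F]
    [ValuativeRel F] [TopologicalSpace F] [IsNonarchimedeanLocalField F] : Prop :=
  ∀ (n : ℕ), 2 ≤ n → ∀ (π : SmoothIrrep (GL (Fin n) F)),
    (∃ ψ : AddChar F Circle, ψ.IsContinuousNontrivial ∧ IsGeneric π.ρ ψ) →
    (∀ (ψ : AddChar F Circle), ψ.IsContinuousNontrivial → IsGeneric π.ρ ψ →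
      ∀ (r : ℕ), 0 < r → ∀ (hrn : r < n) (ρ : SmoothIrrep (GL (Fin r) F)),
        ρ.ρ.IsSupercuspidal → IsGeneric ρ.ρ ψ⁻¹ →
        ∀ [MeasurableSpace (GL (Fin r) F ⧸ upperUnitriangular (Fin r) F)]
          [BorelSpace (GL (Fin r) F ⧸ upperUnitriangular (Fin r) F)]
          (ν : Measure (GL (Fin r) F ⧸ upperUnitriangular (Fin r) F))
          [SMulInvariantMeasure (GL (Fin r) F) (GL (Fin r) F ⧸ upperUnitriangular (Fin r) F) ν]
          [IsFiniteMeasureOnCompacts ν] [ν.IsOpenPosMeasure],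
          HasRSLFactor hrn π.ρ ρ.ρ ψ ν 1) →
    π.ρ.IsSupercuspidal

/-- The `… → P = 1` form implies the existence-included form: where `1` is an `L`-polynomial, every
`L`-polynomial is `1` by the proved uniqueness `HasRSLFactor.unique`. [folklore] -/
theorem Henniart2002_isSupercuspidal_of_forall_hasRSLFactor_one_of_eq_one {F : Type} [Field F]
    [ValuativeRel F] [TopologicalSpace F] [IsNonarchimedeanLocalField F]
    (h : Henniart2002_isSupercuspidal_of_forall_hasRSLFactor_eq_one F) :
    Henniart2002_isSupercuspidal_of_forall_hasRSLFactor_one F := by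
  intro n hn π hgen H
  refine h n hn π hgen ?_
  intro ψ hψ hπ r hr hrn ρ hρ hρg _ _ ν _ _ _ P hP
  exact hP.unique (H ψ hψ hπ r hr hrn ρ hρ hρg ν)

end Literature.NumberTheory.Automorphic

end
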